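import Mathlib
import Literature.MathematicalPhysics.QuantumManyBody.PeriodicBoseGas
import Summits.AtomisticToContinuum.BoseEinsteinCondensation.Theses.BECInfDivCoherence

/-!
# Crux `LevyNegativeMoment` (stmt-AtomisticToContinuum-9115), line `registered`, stub `stub_schoenbergDefect` —
# the conditional content at the scale of the sister crux (helper, NOT the registered stub)

The registered stub `LevyNegativePartMoment` (the `(−1)`-moment of the NEGATIVE parts of the grid
Lévy weights of near-minimisers, `Σ_(q≢0) max(−ν̃_q,0)/|k_q| ≤ C(v,η)`, for EVERY grid scale `η > 0`,
uniformly in `N` and `ρ < ρ₀`) is open-problem physics (see `SchoenbergDefect.assessment.md`).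
This helper file (worker W3 of the line lead, landed `--supports` as evidence for the planners' restatement of
9114/9115 under one `∃ η`) records, kernel-checked, the exact conditional content behind the planner's
"follows from the sister crux with `ε = ε(N)`":

* `sum_negPart_div_le_of_floor` — the counting step: a floor `ν_q ≥ −ε` off `q = 0` gives
  `Σ_(q≢0) max(−ν_q,0)/|k_q| ≤ m³ · εL/(2π)` (`|k_q| ≥ 2π/L`).
* `levyNegativePartMoment_at_gridInfDiv_scale` — `GridInfDivCoherence` (stmt-9114, OPEN) implies the
  stub AT THE ONE SCALE `η` it provides (`∃ η`, with `C = 1`), NOT the registered `∀ η`.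

This is NOT the registered stub (which is `∀ η` and unconditional); it does not close or replace it.
-/

namespace Summit.AtomisticToContinuum.BoseEinsteinCondensation.Cruxes.LevyNegativeMoment.Birth

open scoped BigOperators Topology Classical MeasureTheory ComplexConjugate
open Filter Set Function MeasureTheory

/-- Counting step: if `ν_q ≥ −ε` for all `q ≢ 0` (`ε ≥ 0`), then
`Σ_(q≢0) max(−ν_q,0)/((2π/L)‖q̄‖) ≤ m³ · (εL/(2π))`, since `‖q̄‖ ≥ 1` off `0` and there are at
most `m³` classes. [folklore] -/
theorem sum_negPart_div_le_of_floor {m : ℕ} {L ε : ℝ} (hL : 0 < L) (hε : 0 ≤ ε)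
    (ν : (Fin 3 → Fin m) → ℝ)
    (hν : ∀ q : Fin 3 → Fin m, (∃ k, (q k : ℕ) ≠ 0) → -ε ≤ ν q) :
    (∑ q : Fin 3 → Fin m with (∃ k, (q k : ℕ) ≠ 0), max (-(ν q)) 0 /
        (2 * Real.pi / L * Real.sqrt (∑ k, ((min (q k : ℕ) (m - (q k : ℕ)) : ℕ) : ℝ) ^ 2)))
      ≤ (m : ℝ) ^ 3 * (ε * L / (2 * Real.pi)) := by
  have hterm : ∀ q ∈ (Finset.univ.filter fun q : Fin 3 → Fin m => ∃ k, (q k : ℕ) ≠ 0),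
      max (-(ν q)) 0 /
          (2 * Real.pi / L * Real.sqrt (∑ k, ((min (q k : ℕ) (m - (q k : ℕ)) : ℕ) : ℝ) ^ 2))
        ≤ ε * L / (2 * Real.pi) := by
    intro q hq
    have hq' : ∃ k, (q k : ℕ) ≠ 0 := (Finset.mem_filter.mp hq).2
    -- `‖q̄‖² ≥ 1`
    have hone : (1 : ℝ) ≤ ∑ k, ((min (q k : ℕ) (m - (q k : ℕ)) : ℕ) : ℝ) ^ 2 := by
      obtain ⟨k, hk⟩ := hq'
      have hlt := (q k).isLt
      have h1 : (1 : ℝ) ≤ ((min (q k : ℕ) (m - (q k : ℕ)) : ℕ) : ℝ) ^ 2 := by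
        have : 1 ≤ min (q k : ℕ) (m - (q k : ℕ)) := by omega
        have h' : (1 : ℝ) ≤ ((min (q k : ℕ) (m - (q k : ℕ)) : ℕ) : ℝ) := by exact_mod_cast this
        nlinarith
      exact h1.trans (Finset.single_le_sum
        (f := fun a => ((min (q a : ℕ) (m - (q a : ℕ)) : ℕ) : ℝ) ^ 2)
        (fun _ _ => sq_nonneg _) (Finset.mem_univ k))
    have hsqrt : (1 : ℝ) ≤ Real.sqrt (∑ k, ((min (q k : ℕ) (m - (q k : ℕ)) : ℕ) : ℝ) ^ 2) := by
      rw [← Real.sqrt_one]; exact Real.sqrt_le_sqrt hone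
    have hden : 2 * Real.pi / L ≤
        2 * Real.pi / L * Real.sqrt (∑ k, ((min (q k : ℕ) (m - (q k : ℕ)) : ℕ) : ℝ) ^ 2) := by
      have h2 : 0 < 2 * Real.pi / L := by positivity
      nlinarith
    have hnum : max (-(ν q)) 0 ≤ ε := max_le (by linarith [hν q hq']) hε
    have h2 : 0 < 2 * Real.pi / L := by positivity
    calc max (-(ν q)) 0 /
          (2 * Real.pi / L * Real.sqrt (∑ k, ((min (q k : ℕ) (m - (q k : ℕ)) : ℕ) : ℝ) ^ 2))
        ≤ ε / (2 * Real.pi / L) :=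
          div_le_div₀ hε hnum h2 hden
      _ = ε * L / (2 * Real.pi) := by
          field_simp
  calc (∑ q : Fin 3 → Fin m with (∃ k, (q k : ℕ) ≠ 0), max (-(ν q)) 0 /
          (2 * Real.pi / L * Real.sqrt (∑ k, ((min (q k : ℕ) (m - (q k : ℕ)) : ℕ) : ℝ) ^ 2)))
      ≤ ∑ q : Fin 3 → Fin m with (∃ k, (q k : ℕ) ≠ 0), ε * L / (2 * Real.pi) :=
        Finset.sum_le_sum hterm
    _ = ((Finset.univ.filter fun q : Fin 3 → Fin m => ∃ k, (q k : ℕ) ≠ 0).card : ℝ) *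
          (ε * L / (2 * Real.pi)) := by
        rw [Finset.sum_const, nsmul_eq_mul]
    _ ≤ (m : ℝ) ^ 3 * (ε * L / (2 * Real.pi)) := by
        refine mul_le_mul_of_nonneg_right ?_ (by positivity)
        have hc : (Finset.univ.filter fun q : Fin 3 → Fin m => ∃ k, (q k : ℕ) ≠ 0).card
            ≤ m ^ 3 := by
          calc (Finset.univ.filter fun q : Fin 3 → Fin m => ∃ k, (q k : ℕ) ≠ 0).card
              ≤ (Finset.univ : Finset (Fin 3 → Fin m)).card := Finset.card_filter_le _ _
            _ = m ^ 3 := by simp [Finset.card_univ]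
        exact_mod_cast hc

/-- **The conditional content of the stub at the sister crux's scale.** `GridInfDivCoherence`
(stmt-AtomisticToContinuum-9114: `∃ η`, `∀ ε ∃ δ` after `N`) implies the negative-part
`(−1)`-moment bound with `C = 1` AT THAT `η`: choose `ε(N) = 2π/(L(m³+1))` and count
(`sum_negPart_div_le_of_floor`). This is an `∃ η` statement; the registered stub quantifies
`∀ η > 0`, which does not follow. [folklore] -/
theorem levyNegativePartMoment_at_gridInfDiv_scale
    (h : Summit.AtomisticToContinuum.BoseEinsteinCondensation.Theses.BECInfDivCoherence.GridInfDivCoherence) :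
    ∀ v : ℝ → ENNReal, Literature.MathematicalPhysics.QuantumManyBody.BoseGas.IsRepulsiveFiniteRange v → ∃ η : ℝ, 0 < η ∧ ∃ C : ℝ, ∃ ρ₀ : ℝ, 0 < ρ₀ ∧ ∀ ρ : ℝ, 0 < ρ → ρ < ρ₀ → ∀ᶠ N : ℕ in Filter.atTop, ∃ δ : ENNReal, 0 < δ ∧ ∀ Ψ : Literature.MathematicalPhysics.QuantumManyBody.BoseGas.PeriodicTrialState N (Literature.MathematicalPhysics.QuantumManyBody.BoseGas.sideLength ρ N), Literature.MathematicalPhysics.QuantumManyBody.BoseGas.periodicEnergy v Ψ ≤ Literature.MathematicalPhysics.QuantumManyBody.BoseGas.periodicGroundStateEnergy v N (Literature.MathematicalPhysics.QuantumManyBody.BoseGas.sideLength ρ N) + δ → ∀ i : Fin N, let L : ℝ := Literature.MathematicalPhysics.QuantumManyBody.BoseGas.sideLength ρ N; let m : ℕ := ⌊L / η⌋₊; let G : EuclideanSpace ℝ (Fin 3) → ℝ := fun r => (∫ X in Literature.MathematicalPhysics.QuantumManyBody.BoseGas.cellN N L, conj (Ψ.ψ (Function.update X i (X i + r))) * Ψ.ψ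 X).re; let ν : (Fin 3 → Fin m) → ℝ := fun q => (∑ j : Fin 3 → Fin m, Real.log (G (Literature.MathematicalPhysics.QuantumManyBody.BoseGas.latticeVec (L / m) (fun k => ((j k : ℕ) : ℤ)))) * Real.cos (2 * Real.pi * (∑ k, ((q k : ℕ) : ℝ) * ((j k : ℕ) : ℝ)) / m)) / (m : ℝ) ^ 3; (∑ q : Fin 3 → Fin m with (∃ k, (q k : ℕ) ≠ 0), max (-(ν q)) 0 / (2 * Real.pi / L * Real.sqrt (∑ k, ((min (q k : ℕ) (m - (q k : ℕ)) : ℕ) : ℝ) ^ 2))) ≤ C := by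
  intro v hv
  obtain ⟨η, hη, ρ₀, hρ₀, H⟩ := h v hv
  refine ⟨η, hη, 1, ρ₀, hρ₀, fun ρ hρ hρlt => ?_⟩
  filter_upwards [H ρ hρ hρlt, Filter.eventually_gt_atTop 0] with N hN hNpos
  -- the scale-dependent tolerance `ε(N) = 2π / (L (m³ + 1))`
  have hL : 0 < Literature.MathematicalPhysics.QuantumManyBody.BoseGas.sideLength ρ N := by
    unfold Literature.MathematicalPhysics.QuantumManyBody.BoseGas.sideLength
    exact Real.rpow_pos_of_pos (div_pos (Nat.cast_pos.mpr hNpos) hρ) _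
  set L : ℝ := Literature.MathematicalPhysics.QuantumManyBody.BoseGas.sideLength ρ N with hLdef
  set m : ℕ := ⌊L / η⌋₊ with hmdef
  set ε : ℝ := 2 * Real.pi / (L * ((m : ℝ) ^ 3 + 1)) with hεdef
  have hε : 0 < ε := by positivity
  obtain ⟨δ, hδ, K⟩ := hN ε hε
  refine ⟨δ, hδ, fun Ψ hΨ i => ?_⟩
  have P := (K Ψ hΨ i).2
  dsimp only at P ⊢
  refine (sum_negPart_div_le_of_floor hL hε.le _ P).trans ?_
  -- `m³ · ε L / (2π) = m³/(m³+1) ≤ 1`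
  have hm3 : (0 : ℝ) ≤ (m : ℝ) ^ 3 := by positivity
  rw [hεdef]
  rw [show (m : ℝ) ^ 3 * (2 * Real.pi / (L * ((m : ℝ) ^ 3 + 1)) * L / (2 * Real.pi))
      = (m : ℝ) ^ 3 / ((m : ℝ) ^ 3 + 1) by field_simp]
  rw [div_le_one (by positivity)]
  linarith

end Summit.AtomisticToContinuum.BoseEinsteinCondensation.Cruxes.LevyNegativeMoment.Birth
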